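import Mathlib
import HarnessLib
import Literature.MathematicalPhysics.QuantumLattice.InfraredCutoffGramConstant
import Summits.HubbardSuperconductivity.HubbardSuperconductivity.Theorems.KLProgrammeKLRegimeSplitEdgeFactsTransfer
import Summits.HubbardSuperconductivity.HubbardSuperconductivity.Theorems.KLProgrammeKLRegimeSplitFrameEnergyGap
import Summits.HubbardSuperconductivity.HubbardSuperconductivity.Theorems.KLProgrammeKLRegimeFrameShellCount

/-!
# Route `KLProgramme` — ENGINE child gen 8 (stmt-HubbardSuperconductivity-20437 `KLRegimeEngineV17F2`), skeleton v2 class #5 «(S)-transfer» rev 2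
# (`…EngineV8PairTransferExport2`, p576787): the two MODEL LINES of the pinned transfer weight — MASS `Σ_p |t_n[φ](Qm,p)| ≤ 2^16` and
# SIGN `Σ_p (|t| + t) ≤ klEdge G n |Qm|_𝕋` — n-UNIFORMLY, for every admissible symbol on every admissible frame (cell gate-hubbard-kl, seat p1 g12)

WHY.  (R54)(ii) books to the p1 lineage the two estimate lines the bridge `pairTransferAtCov_of_pinned` / `PairTransferPinnedFamily.hard_of_lines`
(p576787) takes as hypotheses: `Σ_p |klTransferWeight … (K_n) n φ Qm p| ≤ G.bhi/4` and `Σ_p (|t| + t) ≤ klEdge G n |Qm|_𝕋`.  The weight is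
`t = −(βL²)⁻¹·Re Σ_ν [w_{Λ_n}(ν,p)φ(−ν,Qm−p) + φ(ν,p)w_{Λ_n}(−ν,Qm−p)]·ĝ_K(ν,p)ĝ_K(−ν,Qm−p)`: one HARD line (`w_{Λ_n} ≠ 0 ⇒ ω² + e² > Λ_n²/4 ⇒
|ĝ| < 2/Λ_n`) times one SOFT line (`0 ≤ φ ≤ 1 − w_{Λ_n}`, so `φ|ĝ| ≤ (1 − w_{Λ_n})/√(ω² + e²)`).  No AM–GM split (the soft `Q = 0` mass is
`log(Λ_nβ)`-divergent); instead the product bound `(2/Λ_n)·Σ_k (1 − w_{Λ_n}(k))/√(ω² + e_K²)` and the SCALE-LINEAR infrared phase-space sum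
`Σ_k (1 − w_Λ)/√(…) ≤ (7c₁ + 4c₂)·Λ·βL²` (`Literature.….sum_one_sub_hubbardCutoffWeightCT_div_sqrt_le_linear`, p579393, Pedra–Salmhofer 2008 Lemma 5.1 with
the rounding term absorbed by `ΛL ≥ π`) with the frame level count `(c₁, c₂) = (1793, 704)` of `card_frameLevel_lt_le` (FrameOK (i)): the `Λ_n` CANCELS,
`Σ_p |t| ≤ 4·(7·1793 + 4·704) = 61468 < 2^16` at every scale, every pair momentum `Qm` (no pair-class hypothesis), every `M`, `β ≥ klBetaMin`, `L ≥ β`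
(below the thermal scale, `Λ_n < π/β`, every soft symbol vanishes and `t ≡ 0`).
* §1 line sizes: `norm_propCT_eq` (`‖ĝ_K(k)‖ = (√(ω² + e_K²))⁻¹`), `hubbardCutoffWeightCT_mul_norm_propCT_le` (hard `≤ 2/Λ`),
  `softSymbol_mul_norm_propCT_le` (soft `≤ (1 − w)/√(…)`);
* §2 `abs_klTransferWeight_le` (termwise) and **`sum_abs_klTransferWeight_le_soft`**: `Σ_p |t| ≤ (βL²)⁻¹·(4/Λ_n)·Σ_k (1 − w_{Λ_n}(k))/√(ω² + e_K²)`
  (the reindexing `(ν,p) ↦ (−ν, Qm − p)` for the first rung);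
* §3 **`sum_abs_klTransferWeight_le_of_frameOK`**: `FrameOK R U N μ K → klBetaMin ≤ β → β ≤ L → (0 ≤ φ ≤ 1 − w^K_{Λ_n}) → Σ_p |t_n[φ](Qm,p)| ≤ 2^16`;
* §4 SIGN: `klTransferWeight_nonpos_of_deep` (`klEdgeKappa·|Qm|_𝕋 ≤ Λ_n ⇒ t ≤ 0` pointwise: each rung `a/((iω − e₁)(−iω − e₂))`, `a ≥ 0`, has `Re ≥ 0` —
  if `ω² + e₁e₂ < 0` then by `kled_sq_add_mul_nonneg(')` + the deep gap `|e₁ − e₂| ≤ Λ_n/2` (`kled_gap_deep_of_frameOK`) NEITHER line is hard, so `a = 0`),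
  **`sum_abs_add_self_klTransferWeight_le_klEdge`** (`2^17 ≤ G.bhi ⇒ Σ_p (|t| + t) ≤ klEdge G n |Qm|_𝕋`: `0` deep inside, `≤ 2·2^16 ≤ G.bhi = klEdge` at the edge);
* §5 the BY-NAME dischargers at the flowing frame `K_n = klFlowFrameU … n`: `klTransferWeight_massLine` (`… ≤ G.bhi/4` from `2^18 ≤ G.bhi`),
  `klTransferWeight_signLine`, **`pairTransferAtCov_of_pinned_of_frameOK`** and **`PairTransferPinnedFamily.hard_of_frameOK`** (rev 1's per-member /
  complementary-family texts from the pinned clause ALONE, under `FrameOK R U N μ (K_n)`, `klBetaMin ≤ β ≤ L`, `2^18 ≤ G.bhi` — `klEngGeo8.bhi = 2^24`).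
Everything is proved; no definition; nothing about the effective action is asserted (the pinned clause itself is the class-#5 producer's obligation).  0 kit.
-/

noncomputable section

namespace Summit.HubbardSuperconductivity.HubbardSuperconductivity.Theorems.KLRegimeSplit

set_option linter.dupNamespace false -- summit = problem name (single-conjunct summit), D-0017

open Real Finset Complex Literature.MathematicalPhysics.QuantumLattice Literature.Probability.LatticeModels
open Summit.HubbardSuperconductivity.HubbardSuperconductivity.Theorems.KLProgrammeLegKernels
open Summit.HubbardSuperconductivity.HubbardSuperconductivity.Theorems.TwoPointAssembly

/-! ## §1 Line sizes: the frame propagator, the hard line, the soft line -/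

section Lines

variable {L M : ℕ} (β μ : ℝ) (K : TrigPolyC4v)

/-- `‖−iω + e‖ = √(ω² + e²)`. -/
theorem norm_neg_I_mul_add_ofReal (ω e : ℝ) : ‖(-I * ω + e : ℂ)‖ = Real.sqrt (ω ^ 2 + e ^ 2) := by
  have h : ‖(-I * ω + e : ℂ)‖ ^ 2 = ω ^ 2 + e ^ 2 := by
    rw [Complex.sq_norm, Complex.normSq_apply]
    simp only [add_re, add_im, mul_re, mul_im, neg_re, neg_im, I_re, I_im, ofReal_re, ofReal_im]
    ring
  rw [← h, Real.sqrt_sq (norm_nonneg _)]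

/-- **The frame propagator's size**: `‖ĝ_K(k)‖ = (√(ω_k² + e_K(k⃗)²))⁻¹`. -/
theorem norm_propCT_eq (k : FreqMomentum L M) :
    ‖propCT L M β μ K k‖ = (Real.sqrt (matsubaraFreq β M k.1 ^ 2 + nambuXiCT L μ K k.2 ^ 2))⁻¹ := by
  rw [propCT, norm_div, norm_one, norm_neg_I_mul_add_ofReal, one_div]

/-- **The HARD line**: `w^K_Λ(k)·‖ĝ_K(k)‖ ≤ 2/Λ` (`w^K_Λ(k) ≠ 0` forces `ω² + e_K² > Λ²/4`; `0 ≤ w ≤ 1`). -/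
theorem hubbardCutoffWeightCT_mul_norm_propCT_le {Λ : ℝ} (hΛ : 0 < Λ) (k : FreqMomentum L M) :
    hubbardCutoffWeightCT L M β μ K Λ k * ‖propCT L M β μ K k‖ ≤ 2 / Λ := by
  have hw := salmhoferCutoff_mem_Icc ((matsubaraFreq β M k.1 ^ 2 + nambuXiCT L μ K k.2 ^ 2) / Λ ^ 2)
  set r2 := matsubaraFreq β M k.1 ^ 2 + nambuXiCT L μ K k.2 ^ 2 with hr2
  by_cases h : r2 / Λ ^ 2 ≤ 1 / 4
  · have h0 : hubbardCutoffWeightCT L M β μ K Λ k = 0 := salmhoferCutoff_of_le h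
    rw [h0, zero_mul]
    positivity
  · push Not at h
    have hr : Λ ^ 2 / 4 < r2 := by
      rw [lt_div_iff₀ (by positivity)] at h
      linarith
    have hsqrt : Λ / 2 < Real.sqrt r2 := by
      rw [show Λ / 2 = Real.sqrt ((Λ / 2) ^ 2) from (Real.sqrt_sq (by positivity)).symm]
      exact Real.sqrt_lt_sqrt (by positivity) (by linarith)
    have hw1 : hubbardCutoffWeightCT L M β μ K Λ k ≤ 1 := hw.2
    calc hubbardCutoffWeightCT L M β μ K Λ k * ‖propCT L M β μ K k‖ ≤ 1 * ‖propCT L M β μ K k‖ :=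
          mul_le_mul_of_nonneg_right hw1 (norm_nonneg _)
      _ = (Real.sqrt r2)⁻¹ := by rw [one_mul, norm_propCT_eq]
      _ ≤ (Λ / 2)⁻¹ := inv_anti₀ (by positivity) hsqrt.le
      _ = 2 / Λ := by rw [inv_div]

/-- **The SOFT line**: a fraction `0 ≤ φ ≤ 1 − w^K_Λ` of the propagator has `φ(k)·‖ĝ_K(k)‖ ≤ (1 − w^K_Λ(k))/√(ω² + e_K²)`. -/
theorem softSymbol_mul_norm_propCT_le {Λ : ℝ} {φ : FreqMomentum L M → ℝ}
    (hφ : ∀ k, 0 ≤ φ k ∧ φ k ≤ 1 - hubbardCutoffWeightCT L M β μ K Λ k) (k : FreqMomentum L M) :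
    φ k * ‖propCT L M β μ K k‖ ≤
      (1 - hubbardCutoffWeightCT L M β μ K Λ k) / Real.sqrt (matsubaraFreq β M k.1 ^ 2 + nambuXiCT L μ K k.2 ^ 2) := by
  rw [norm_propCT_eq, ← div_eq_mul_inv]
  exact div_le_div_of_nonneg_right (hφ k).2 (Real.sqrt_nonneg _)

/-- Below the thermal scale every soft fraction vanishes: `Λ < π/β`, `0 < β`, `0 < Λ` ⇒ `w^K_Λ ≡ 1`, so `0 ≤ φ ≤ 1 − w^K_Λ` forces `φ ≡ 0`. -/
theorem softSymbol_eq_zero_of_lt_pi_div {Λ : ℝ} (hβ : 0 < β) (hΛ : 0 < Λ) (hΛβ : Λ < Real.pi / β) {φ : FreqMomentum L M → ℝ}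
    (hφ : ∀ k, 0 ≤ φ k ∧ φ k ≤ 1 - hubbardCutoffWeightCT L M β μ K Λ k) (k : FreqMomentum L M) : φ k = 0 := by
  have hω : Λ ≤ |matsubaraFreq β M k.1| :=
    hΛβ.le.trans (Literature.MathematicalPhysics.QuantumLattice.pi_div_le_abs_matsubaraFreq hβ k.1)
  have hw : hubbardCutoffWeightCT L M β μ K Λ k = 1 := by
    refine salmhoferCutoff_of_ge ?_
    rw [le_div_iff₀ (by positivity), one_mul]
    have h1 : Λ ^ 2 ≤ matsubaraFreq β M k.1 ^ 2 := by
      rw [← sq_abs (matsubaraFreq β M k.1)]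
      exact pow_le_pow_left₀ hΛ.le hω 2
    nlinarith [sq_nonneg (nambuXiCT L μ K k.2)]
  have := hφ k
  rw [hw, sub_self] at this
  linarith [this.1, this.2]

end Lines

/-! ## §2 The termwise bound and the product bound `(βL²)⁻¹·(4/Λ_n)·(soft phase-space sum)` -/

section Mass

variable {L M : ℕ} [NeZero L] (β μ : ℝ) (K : TrigPolyC4v)

omit [NeZero L] in
/-- **Termwise**: `|t_n[φ](Qm,p)| ≤ (βL²)⁻¹·Σ_ν (w(ν,p)φ(−ν,Qm−p) + φ(ν,p)w(−ν,Qm−p))·‖ĝ(ν,p)‖·‖ĝ(−ν,Qm−p)‖` (`0 < β`, `0 ≤ φ`). -/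
theorem abs_klTransferWeight_le (hβ : 0 < β) (n : ℕ) {φ : FreqMomentum L M → ℝ} (hφ0 : ∀ k, 0 ≤ φ k) (Qm p : TorusSite 2 L) :
    |klTransferWeight L M β μ K n φ Qm p| ≤
      (β * (L : ℝ) ^ 2)⁻¹ * ∑ ν : MatsubaraIdx M,
        (hubbardCutoffWeightCT L M β μ K (klScale klE0 n) (ν, p) * φ (ν.rev, Qm - p) +
            φ (ν, p) * hubbardCutoffWeightCT L M β μ K (klScale klE0 n) (ν.rev, Qm - p)) *
          (‖propCT L M β μ K (ν, p)‖ * ‖propCT L M β μ K (ν.rev, Qm - p)‖) := by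
  have hc : 0 ≤ (β * (L : ℝ) ^ 2)⁻¹ := by positivity
  rw [klTransferWeight_def, abs_neg, abs_mul, abs_of_nonneg hc]
  refine mul_le_mul_of_nonneg_left ?_ hc
  refine (Complex.abs_re_le_norm _).trans ((norm_sum_le _ _).trans (le_of_eq (sum_congr rfl fun ν _ => ?_)))
  have hw1 : 0 ≤ hubbardCutoffWeightCT L M β μ K (klScale klE0 n) (ν, p) := (salmhoferCutoff_mem_Icc _).1
  have hw2 : 0 ≤ hubbardCutoffWeightCT L M β μ K (klScale klE0 n) (ν.rev, Qm - p) := (salmhoferCutoff_mem_Icc _).1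
  have ha : 0 ≤ hubbardCutoffWeightCT L M β μ K (klScale klE0 n) (ν, p) * φ (ν.rev, Qm - p) +
      φ (ν, p) * hubbardCutoffWeightCT L M β μ K (klScale klE0 n) (ν.rev, Qm - p) :=
    add_nonneg (mul_nonneg hw1 (hφ0 _)) (mul_nonneg (hφ0 _) hw2)
  rw [norm_mul, norm_mul, Complex.norm_real, Real.norm_eq_abs, abs_of_nonneg ha]

/-- **The product bound**: for `0 < β` and a soft fraction `0 ≤ φ ≤ 1 − w^K_{Λ_n}`, at EVERY pair momentum `Qm`,
`Σ_p |t_n[φ](Qm,p)| ≤ (βL²)⁻¹·(4/Λ_n)·Σ_k (1 − w^K_{Λ_n}(k))/√(ω_k² + e_K(k⃗)²)` — hard line `≤ 2/Λ_n` on each of the two rungs, the partner rung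
reindexed by `(ν,p) ↦ (−ν, Qm − p)`. -/
theorem sum_abs_klTransferWeight_le_soft (hβ : 0 < β) (n : ℕ) {φ : FreqMomentum L M → ℝ}
    (hφ : ∀ k, 0 ≤ φ k ∧ φ k ≤ 1 - hubbardCutoffWeightCT L M β μ K (klScale klE0 n) k) (Qm : TorusSite 2 L) :
    ∑ p, |klTransferWeight L M β μ K n φ Qm p| ≤
      (β * (L : ℝ) ^ 2)⁻¹ * (4 / klScale klE0 n) *
        ∑ k : FreqMomentum L M, (1 - hubbardCutoffWeightCT L M β μ K (klScale klE0 n) k) /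
          Real.sqrt (matsubaraFreq β M k.1 ^ 2 + nambuXiCT L μ K k.2 ^ 2) := by
  have hΛ : 0 < klScale klE0 n := klth_klScale_pos n
  have hc : 0 ≤ (β * (L : ℝ) ^ 2)⁻¹ := by positivity
  -- the two line values
  set hard : FreqMomentum L M → ℝ := fun k => hubbardCutoffWeightCT L M β μ K (klScale klE0 n) k * ‖propCT L M β μ K k‖ with hhard
  set soft : FreqMomentum L M → ℝ := fun k => φ k * ‖propCT L M β μ K k‖ with hsoft
  set S : ℝ := ∑ k : FreqMomentum L M, (1 - hubbardCutoffWeightCT L M β μ K (klScale klE0 n) k) /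
    Real.sqrt (matsubaraFreq β M k.1 ^ 2 + nambuXiCT L μ K k.2 ^ 2) with hS
  have hhard_le : ∀ k, hard k ≤ 2 / klScale klE0 n := fun k => hubbardCutoffWeightCT_mul_norm_propCT_le β μ K hΛ k
  have hhard0 : ∀ k, 0 ≤ hard k := fun k => mul_nonneg (salmhoferCutoff_mem_Icc _).1 (norm_nonneg _)
  have hsoft0 : ∀ k, 0 ≤ soft k := fun k => mul_nonneg (hφ k).1 (norm_nonneg _)
  have hsoft_sum : ∑ k, soft k ≤ S := sum_le_sum fun k _ => softSymbol_mul_norm_propCT_le β μ K hφ k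
  -- termwise in the two line values
  have hterm : ∀ p, |klTransferWeight L M β μ K n φ Qm p| ≤
      (β * (L : ℝ) ^ 2)⁻¹ * ∑ ν : MatsubaraIdx M, (hard (ν, p) * soft (ν.rev, Qm - p) + soft (ν, p) * hard (ν.rev, Qm - p)) := by
    intro p
    refine (abs_klTransferWeight_le β μ K hβ n (fun k => (hφ k).1) Qm p).trans (le_of_eq ?_)
    congr 1
    refine sum_congr rfl fun ν _ => ?_
    simp only [hhard, hsoft]
    ring
  -- reindex the first rung's partner
  have hreindex : ∑ p : TorusSite 2 L, ∑ ν : MatsubaraIdx M, soft (ν.rev, Qm - p) = ∑ k, soft k := by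
    have h1 : ∀ p : TorusSite 2 L, ∑ ν : MatsubaraIdx M, soft (ν.rev, Qm - p) = ∑ ν : MatsubaraIdx M, soft (ν, Qm - p) := fun p =>
      Equiv.sum_comp Fin.revPerm (fun ν => soft (ν, Qm - p))
    simp_rw [h1]
    have h2 : ∑ p : TorusSite 2 L, ∑ ν : MatsubaraIdx M, soft (ν, Qm - p) = ∑ p : TorusSite 2 L, ∑ ν : MatsubaraIdx M, soft (ν, p) :=
      Fintype.sum_equiv (Equiv.subLeft Qm) _ _ fun p => rfl
    rw [h2, Fintype.sum_prod_type, sum_comm]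
  have hplain : ∑ p : TorusSite 2 L, ∑ ν : MatsubaraIdx M, soft (ν, p) = ∑ k, soft k := by
    rw [Fintype.sum_prod_type, sum_comm]
  have hA : ∑ p : TorusSite 2 L, ∑ ν : MatsubaraIdx M, hard (ν, p) * soft (ν.rev, Qm - p) ≤ 2 / klScale klE0 n * ∑ k, soft k := by
    rw [← hreindex, mul_sum]
    refine sum_le_sum fun p _ => ?_
    rw [mul_sum]
    exact sum_le_sum fun ν _ => mul_le_mul_of_nonneg_right (hhard_le _) (hsoft0 _)
  have hB : ∑ p : TorusSite 2 L, ∑ ν : MatsubaraIdx M, soft (ν, p) * hard (ν.rev, Qm - p) ≤ 2 / klScale klE0 n * ∑ k, soft k := by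
    rw [← hplain, mul_sum]
    refine sum_le_sum fun p _ => ?_
    rw [mul_sum]
    exact sum_le_sum fun ν _ => by
      rw [mul_comm (2 / klScale klE0 n)]
      exact mul_le_mul_of_nonneg_left (hhard_le _) (hsoft0 _)
  calc ∑ p, |klTransferWeight L M β μ K n φ Qm p|
      ≤ ∑ p, (β * (L : ℝ) ^ 2)⁻¹ * ∑ ν : MatsubaraIdx M, (hard (ν, p) * soft (ν.rev, Qm - p) + soft (ν, p) * hard (ν.rev, Qm - p)) :=
        sum_le_sum fun p _ => hterm p
    _ = (β * (L : ℝ) ^ 2)⁻¹ * (∑ p, ∑ ν : MatsubaraIdx M, hard (ν, p) * soft (ν.rev, Qm - p) +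
          ∑ p, ∑ ν : MatsubaraIdx M, soft (ν, p) * hard (ν.rev, Qm - p)) := by
        rw [← mul_sum, ← sum_add_distrib]
        congr 1
        exact sum_congr rfl fun p _ => sum_add_distrib
    _ ≤ (β * (L : ℝ) ^ 2)⁻¹ * (2 / klScale klE0 n * ∑ k, soft k + 2 / klScale klE0 n * ∑ k, soft k) :=
        mul_le_mul_of_nonneg_left (add_le_add hA hB) hc
    _ = (β * (L : ℝ) ^ 2)⁻¹ * (4 / klScale klE0 n) * ∑ k, soft k := by ring
    _ ≤ (β * (L : ℝ) ^ 2)⁻¹ * (4 / klScale klE0 n) * S :=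
        mul_le_mul_of_nonneg_left hsoft_sum (by positivity)

end Mass

/-! ## §3 The MASS line on admissible frames: `Σ_p |t_n[φ](Qm,p)| ≤ 2^16`, uniformly in `n`, `Qm`, `M` -/

section MassFrame

variable {L M : ℕ} [NeZero L] {R : RenConsts} {U : ℝ} {N : ℕ} {β μ : ℝ} {K : TrigPolyC4v}

/-- **The soft phase-space sum at scale `Λ_n` on an admissible frame**: `π/β ≤ Λ_n`, `0 < β ≤ L` ⇒
`Σ_k (1 − w^K_{Λ_n}(k))/√(ω² + e_K²) ≤ 15367·Λ_n·βL²` (`15367 = 7·1793 + 4·704`, the frame level count of `card_frameLevel_lt_le`). -/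
theorem sum_softLine_le_of_frameOK (hK : FrameOK R U N μ K) (hβ : 0 < β) (hβL : β ≤ L) {n : ℕ}
    (hn : Real.pi / β ≤ klScale klE0 n) :
    ∑ k : FreqMomentum L M, (1 - hubbardCutoffWeightCT L M β μ K (klScale klE0 n) k) /
        Real.sqrt (matsubaraFreq β M k.1 ^ 2 + nambuXiCT L μ K k.2 ^ 2) ≤
      15367 * klScale klE0 n * β * (L : ℝ) ^ 2 := by
  have hΛ : 0 < klScale klE0 n := klth_klScale_pos n
  have htube : klScale klE0 n < 3 / 80 := klScale_klE0_lt_tube n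
  have h := sum_one_sub_hubbardCutoffWeightCT_div_sqrt_le_linear (M := M) hβ μ K hΛ hn hβL (by norm_num : (0 : ℝ) ≤ 1793)
    (by norm_num : (0 : ℝ) ≤ 704) fun η hη hηΛ => card_frameLevel_lt_le hK hη (by linarith)
  refine h.trans (le_of_eq ?_)
  norm_num

/-- **MASS LINE (model lemma (ii), p1 lineage)**: on every admissible frame, for `β ≥ klBetaMin`, `L ≥ β`, every scale `n`, every soft fraction
`0 ≤ φ ≤ 1 − w^K_{Λ_n}` and EVERY pair momentum `Qm`: `Σ_p |klTransferWeight … n φ Qm p| ≤ 2^16` (`= 4·15367 = 61468` rounded up; at scales below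
the temperature the weight vanishes identically). -/
theorem sum_abs_klTransferWeight_le_of_frameOK (hK : FrameOK R U N μ K) (hβ : klBetaMin ≤ β) (hβL : β ≤ L) (n : ℕ)
    {φ : FreqMomentum L M → ℝ} (hφ : ∀ k, 0 ≤ φ k ∧ φ k ≤ 1 - hubbardCutoffWeightCT L M β μ K (klScale klE0 n) k)
    (Qm : TorusSite 2 L) : ∑ p, |klTransferWeight L M β μ K n φ Qm p| ≤ 2 ^ 16 := by
  have hβ0 : 0 < β := pos_of_klBetaMin_le hβ
  have hΛ : 0 < klScale klE0 n := klth_klScale_pos n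
  have hL : (0 : ℝ) < L := lt_of_lt_of_le hβ0 hβL
  rcases le_or_gt (Real.pi / β) (klScale klE0 n) with hth | hth
  · -- above the temperature: product bound × scale-linear phase-space sum; `Λ_n` cancels
    have h1 := sum_abs_klTransferWeight_le_soft β μ K hβ0 n hφ Qm
    have h2 := sum_softLine_le_of_frameOK (M := M) hK hβ0 hβL hth
    have hc : 0 ≤ (β * (L : ℝ) ^ 2)⁻¹ * (4 / klScale klE0 n) := by positivity
    refine h1.trans ((mul_le_mul_of_nonneg_left h2 hc).trans ?_)
    have hne : β * (L : ℝ) ^ 2 ≠ 0 := by positivity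
    calc (β * (L : ℝ) ^ 2)⁻¹ * (4 / klScale klE0 n) * (15367 * klScale klE0 n * β * (L : ℝ) ^ 2) = 61468 := by
          field_simp
          ring
      _ ≤ 2 ^ 16 := by norm_num
  · -- below the temperature: every soft fraction vanishes, so does the weight
    have hφ0 : ∀ k, φ k = 0 := softSymbol_eq_zero_of_lt_pi_div β μ K hβ0 hΛ hth hφ
    have hz : (φ : FreqMomentum L M → ℝ) = fun _ => 0 := funext hφ0
    subst hz
    simp only [klTransferWeight_zero_symbol, abs_zero, sum_const_zero]
    norm_num

end MassFrame

/-! ## §4 The SIGN line: `t ≤ 0` deep inside the pair class, `Σ_p (|t| + t) ≤ klEdge G n |Qm|_𝕋` -/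

section Sign

variable {L M : ℕ} [NeZero L] {R : RenConsts} {U : ℝ} {N : ℕ} {β μ : ℝ} {K : TrigPolyC4v}

omit [NeZero L] in
/-- The two rungs' product `ĝ_K(ν,p)·ĝ_K(−ν,q)` is the `kled` pair denominator `1/((iω − e_K(p))(−iω − e_K(q)))`. -/
theorem propCT_mul_propCT_rev (β μ : ℝ) (K : TrigPolyC4v) (ν : MatsubaraIdx M) (p q : TorusSite 2 L) :
    propCT L M β μ K (ν, p) * propCT L M β μ K (ν.rev, q) =
      1 / ((I * (matsubaraFreq β M ν : ℝ) - (nambuXiCT L μ K p : ℝ)) * (-I * (matsubaraFreq β M ν : ℝ) - (nambuXiCT L μ K q : ℝ))) := by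
  rw [propCT, propCT, matsubaraFreq_rev, ← kled_pairDenom_eq]
  push_cast
  rw [div_mul_div_comm, one_mul]
  ring

/-- **Deep inside the class the pinned weight is NONPOSITIVE, pointwise**: on an admissible frame, `0 < β`, `0 ≤ φ ≤ 1 − w^K_{Λ_n}`,
`klEdgeKappa·|Qm|_𝕋 ≤ Λ_n` ⇒ `klTransferWeight … n φ Qm p ≤ 0` for every `p` (every rung has nonnegative real part: its numerator is `≥ 0`, and if
`ω² + e_K(p)e_K(Qm−p) < 0` then, the pair-energy gap being `≤ Λ_n/2`, neither line can be hard, so the numerator is `0`). -/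
theorem klTransferWeight_nonpos_of_deep (hK : FrameOK R U N μ K) (hβ : 0 < β) (n : ℕ) {φ : FreqMomentum L M → ℝ}
    (hφ : ∀ k, 0 ≤ φ k ∧ φ k ≤ 1 - hubbardCutoffWeightCT L M β μ K (klScale klE0 n) k) {Qm : TorusSite 2 L}
    (hdeep : klEdgeKappa * klTorusNorm L Qm ≤ klScale klE0 n) (p : TorusSite 2 L) : klTransferWeight L M β μ K n φ Qm p ≤ 0 := by
  have hc : 0 ≤ (β * (L : ℝ) ^ 2)⁻¹ := by positivity
  rw [klTransferWeight_def, neg_nonpos]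
  refine mul_nonneg hc ?_
  rw [re_sum]
  refine sum_nonneg fun ν _ => ?_
  set Λ := klScale klE0 n with hΛdef
  have hΛ : 0 < Λ := klth_klScale_pos n
  set ω := matsubaraFreq β M ν with hω
  set e₁ := nambuXiCT L μ K p with he₁
  set e₂ := nambuXiCT L μ K (Qm - p) with he₂
  set w₁ := hubbardCutoffWeightCT L M β μ K Λ (ν, p) with hw₁def
  set w₂ := hubbardCutoffWeightCT L M β μ K Λ (ν.rev, Qm - p) with hw₂def
  have hw₁ : 0 ≤ w₁ := (salmhoferCutoff_mem_Icc _).1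
  have hw₂ : 0 ≤ w₂ := (salmhoferCutoff_mem_Icc _).1
  have ha : 0 ≤ w₁ * φ (ν.rev, Qm - p) + φ (ν, p) * w₂ := add_nonneg (mul_nonneg hw₁ (hφ _).1) (mul_nonneg (hφ _).1 hw₂)
  have hgap : |e₁ - e₂| ≤ Λ / 2 := kled_gap_deep_of_frameOK hK p Qm hdeep
  rw [mul_comm, propCT_mul_propCT_rev, ← hω, ← he₁, ← he₂, one_div, ← div_eq_inv_mul]
  by_cases hs : 0 ≤ ω ^ 2 + e₁ * e₂
  · exact kled_pairWeight_re_nonneg ha hs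
  · -- neither line is hard: both weights vanish
    have h1 : ¬ (Λ ^ 2 / 4 ≤ ω ^ 2 + e₁ ^ 2) := fun h => hs (kled_sq_add_mul_nonneg h hgap)
    have h2 : ¬ (Λ ^ 2 / 4 ≤ ω ^ 2 + e₂ ^ 2) := fun h => hs (kled_sq_add_mul_nonneg' h hgap)
    have hw₁0 : w₁ = 0 := by
      refine salmhoferCutoff_of_le ?_
      rw [div_le_iff₀ (by positivity)]
      push Not at h1
      simp only [← hω, ← he₁]
      linarith
    have hw₂0 : w₂ = 0 := by
      refine salmhoferCutoff_of_le ?_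
      rw [div_le_iff₀ (by positivity), matsubaraFreq_rev, neg_sq]
      push Not at h2
      simp only [← hω, ← he₂]
      linarith
    rw [hw₁0, hw₂0, zero_mul, mul_zero, add_zero, Complex.ofReal_zero, zero_div, Complex.zero_re]

/-- **SIGN LINE (model lemma (ii), p1 lineage)**: on every admissible frame, `klBetaMin ≤ β ≤ L`, `0 ≤ φ ≤ 1 − w^K_{Λ_n}`, `2^17 ≤ G.bhi`:
`Σ_p (|t| + t) ≤ klEdge G n |Qm|_𝕋` at EVERY pair momentum `Qm` — deep inside (`klEdgeKappa·|Qm|_𝕋 < Λ_n`) the sum is `0`; in the edge zone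
`klEdge G n |Qm|_𝕋 = G.bhi ≥ 2·2^16 ≥ 2·Σ_p |t|`. -/
theorem sum_abs_add_self_klTransferWeight_le_klEdge (hK : FrameOK R U N μ K) (hβ : klBetaMin ≤ β) (hβL : β ≤ L) (n : ℕ)
    {φ : FreqMomentum L M → ℝ} (hφ : ∀ k, 0 ≤ φ k ∧ φ k ≤ 1 - hubbardCutoffWeightCT L M β μ K (klScale klE0 n) k)
    {G : GeoConsts} (hG : (2 : ℝ) ^ 17 ≤ G.bhi) (Qm : TorusSite 2 L) :
    ∑ p, (|klTransferWeight L M β μ K n φ Qm p| + klTransferWeight L M β μ K n φ Qm p) ≤ klEdge G n (klTorusNorm L Qm) := by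
  have hβ0 : 0 < β := pos_of_klBetaMin_le hβ
  have hbhi : 0 ≤ G.bhi := le_trans (by positivity) hG
  have hρ : 0 ≤ klTorusNorm L Qm := KLProgrammeLegKernels.torusSupNorm_nonneg _
  rcases lt_or_ge (klEdgeKappa * klTorusNorm L Qm) (klScale klE0 n) with hdeep | hedge
  · -- deep inside: every weight is `≤ 0`, the sum vanishes
    have h0 : ∑ p, (|klTransferWeight L M β μ K n φ Qm p| + klTransferWeight L M β μ K n φ Qm p) = 0 :=
      sum_eq_zero fun p _ => by
        have hp := klTransferWeight_nonpos_of_deep hK hβ0 n hφ hdeep.le p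
        rw [abs_of_nonpos hp]; ring
    rw [h0]
    exact klEdge_nonneg hbhi n hρ
  · -- edge zone: no sign information, `|t| + t ≤ 2|t|`
    rw [klEdge_eq_bhi_of_le G hedge]
    have hmass := sum_abs_klTransferWeight_le_of_frameOK hK hβ hβL n hφ Qm
    calc ∑ p, (|klTransferWeight L M β μ K n φ Qm p| + klTransferWeight L M β μ K n φ Qm p)
        ≤ ∑ p, 2 * |klTransferWeight L M β μ K n φ Qm p| :=
          sum_le_sum fun p _ => by linarith [le_abs_self (klTransferWeight L M β μ K n φ Qm p)]
      _ = 2 * ∑ p, |klTransferWeight L M β μ K n φ Qm p| := by rw [mul_sum]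
      _ ≤ 2 * 2 ^ 16 := by linarith
      _ ≤ G.bhi := by linarith

end Sign

/-! ## §5 The by-name dischargers at the flowing frame `K_n = klFlowFrameU … n` -/

section ByName

variable {L M : ℕ} [NeZero L] [NeZero M] {R : RenConsts} {N : ℕ} {G : GeoConsts} {P : SplitConsts} {r β U μ : ℝ} {n : ℕ}

/-- **The MASS hypothesis of `pairTransferAtCov_of_pinned`, discharged**: `FrameOK R U N μ (K_n)`, `klBetaMin ≤ β ≤ L`, `2^18 ≤ G.bhi`, `φ` admissible ⇒
`∀ Qm, IsPairClassAt L Qm n → Σ_p |klTransferWeight … (K_n) n φ Qm p| ≤ G.bhi/4` (the pair-class hypothesis is not used). -/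
theorem klTransferWeight_massLine (hK : FrameOK R U N μ (klFlowFrameU L M β U μ n)) (hβ : klBetaMin ≤ β) (hβL : β ≤ L)
    (hG : (2 : ℝ) ^ 18 ≤ G.bhi) {φ : FreqMomentum L M → ℝ} (hφ : IsSoftSymbol L M β μ (klFlowFrameU L M β U μ n) n φ) :
    ∀ Qm : TorusSite 2 L, IsPairClassAt L Qm n →
      ∑ p, |klTransferWeight L M β μ (klFlowFrameU L M β U μ n) n φ Qm p| ≤ G.bhi / 4 := fun Qm _ =>
  (sum_abs_klTransferWeight_le_of_frameOK hK hβ hβL n hφ.1 Qm).trans (by linarith)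

/-- **The SIGN hypothesis of `pairTransferAtCov_of_pinned`, discharged** (same binders; `2^18 ≤ G.bhi` ⊇ `2^17 ≤ G.bhi`). -/
theorem klTransferWeight_signLine (hK : FrameOK R U N μ (klFlowFrameU L M β U μ n)) (hβ : klBetaMin ≤ β) (hβL : β ≤ L)
    (hG : (2 : ℝ) ^ 18 ≤ G.bhi) {φ : FreqMomentum L M → ℝ} (hφ : IsSoftSymbol L M β μ (klFlowFrameU L M β U μ n) n φ) :
    ∀ Qm : TorusSite 2 L, IsPairClassAt L Qm n →
      ∑ p, (|klTransferWeight L M β μ (klFlowFrameU L M β U μ n) n φ Qm p| + klTransferWeight L M β μ (klFlowFrameU L M β U μ n) n φ Qm p) ≤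
        klEdge G n (klTorusNorm L Qm) := fun Qm _ =>
  sum_abs_add_self_klTransferWeight_le_klEdge hK hβ hβL n hφ.1 (le_trans (by norm_num) hG) Qm

/-- **BRIDGE to rev 1's per-member text, model lines discharged**: on an admissible flowing frame, for `klBetaMin ≤ β ≤ L` and `2^18 ≤ G.bhi`, the pinned
clause of an admissible member ALONE gives `PairTransferAtCov … n (softCovOf … (K_n) φ)` (feeds `pairLadderStepAtV17F2_of_pairTransferAtCov`, p546910). -/
theorem pairTransferAtCov_of_pinned_of_frameOK (hK : FrameOK R U N μ (klFlowFrameU L M β U μ n)) (hβ : klBetaMin ≤ β) (hβL : β ≤ L)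
    (hG : (2 : ℝ) ^ 18 ≤ G.bhi) {φ : FreqMomentum L M → ℝ} (hφ : IsSoftSymbol L M β μ (klFlowFrameU L M β U μ n) n φ)
    (h : PairTransferPinnedAt L M G P r β U μ n φ) :
    PairTransferAtCov L M G P r β U μ n (softCovOf L M β μ (klFlowFrameU L M β U μ n) φ) :=
  pairTransferAtCov_of_pinned (klTransferWeight_massLine hK hβ hβL hG hφ) (klTransferWeight_signLine hK hβ hβL hG hφ) h

/-- **Rev 1's complementary family from the pinned family ALONE** (model lines discharged at every complementary symbol `w_{Λ_m} − w_{Λ_n}`, `n ≤ m`). -/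
theorem PairTransferPinnedFamily.hard_of_frameOK (hK : FrameOK R U N μ (klFlowFrameU L M β U μ n)) (hβ : klBetaMin ≤ β) (hβL : β ≤ L)
    (hG : (2 : ℝ) ^ 18 ≤ G.bhi) (h : PairTransferPinnedFamily L M G P r β U μ n) : PairTransferFamilyHard L M G P r β U μ n :=
  h.hard_of_lines (fun _ hm => klTransferWeight_massLine hK hβ hβL hG (isSoftSymbol_compl β μ _ hm))
    (fun _ hm => klTransferWeight_signLine hK hβ hβL hG (isSoftSymbol_compl β μ _ hm))

end ByName

end Summit.HubbardSuperconductivity.HubbardSuperconductivity.Theorems.KLRegimeSplit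

end
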